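import Summits.AtomisticToContinuum.BoseEinsteinCondensation.Theorems.BECInsertionCorrectorCorrectorClosureVolumeHomotopyReductionBEC
import Summits.AtomisticToContinuum.BoseEinsteinCondensation.Theorems.BECInsertionCorrectorCorrectorClosureReductionToFactors
import Summits.AtomisticToContinuum.BoseEinsteinCondensation.Theorems.BECInsertionCorrectorCorrectorClosureOccupationFloorFK
import HarnessLib

/-!
# Crux `CorrectorClosure` (stmt-AtomisticToContinuum-12058), line `volume-homotopy-sum-rule-domination` —
# composition: the four open stub signatures of skeleton v2 imply the crux (kernel-checked)

Supports (does not close) stmt-AtomisticToContinuum-12058, route `BECInsertionCorrector`.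

Companion of `…VolumeHomotopyReductionBEC.lean` (the two reductions `periodicBEC_of_densityUniformHearts`,
`removalFidelity_of_regularRemovalSusceptibility`).  Here: the fixed-`N` Feynman–Kac frame at ONE bounded
potential (`vhr_residueFloor_at`, `vhr_insertionResidue_at` — per-`v` copies of the landed
`residueFloor_of_factors'` / `correctorClosure_of_factors`, p122159, needed because the volume homotopy
delivers torus BEC on PQSR's SMOOTH class, a sub-class of the bounded potentials) and the composition
`correctorClosure_of_densityUniformHearts`:

  `CorrectorClosure ⇐ [∀ smooth-class v: 12615′(v) ∧ 12616′(v)] ∧ [∀ bounded v: R(v)] ∧ [S7 hole]`,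

with K1 = `StaticResponseBound` consumed inside the first bracket (`stub_longWaveStructureOfSRB`, p134130)
and threaded to the hole.  The four hypotheses are VERBATIM the open stub signatures S2, S3, R, S7 of the
registered skeleton v2 (commit cb08af6fd963), so that a tenure planner can file them as items and re-type
the crux as a conditional bridge citing this theorem (D-0014).

References: skeleton v2 and line card; LSSY (2005) Ch. 5; Reed–Simon IV §XIII.12; Penrose–Onsager (1956) §4.
-/

noncomputable section

open MeasureTheory Filter Matrix
open scoped ENNReal NNReal BigOperators ComplexConjugate

namespace Summit.AtomisticToContinuum.BoseEinsteinCondensation.Theorems.CorrectorClosure.VolumeHomotopySumRuleDomination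

open Literature.MathematicalPhysics.QuantumManyBody.BoseGas
open Summit.AtomisticToContinuum.BoseEinsteinCondensation.Theses.BECInsertionCorrector
open Summit.AtomisticToContinuum.BoseEinsteinCondensation.Theorems.CorrectorClosure.Negative
  (sideLength_succ_pos)
open Summit.AtomisticToContinuum.BoseEinsteinCondensation.Theorems.CorrectorClosure.ResidueAreaLaw
  (stub_groundStateExists stub_occupationFloorFK_of_window taggedZeroModeOccupation_ofReal_eq)
open Summit.AtomisticToContinuum.BoseEinsteinCondensation.Theorems.CorrectorClosure.HealingScaleKacInsertion
  (stub_nearMinimiserRigidity)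

/-! ## The FK frame at ONE bounded potential (per-`v` copy of p122159) -/

/-- **The residue floor from the two factors, at one bounded potential** (per-`v` form of the landed
`residueFloor_of_factors'`, p122159; copied from skeleton v2): torus BEC of near-minimisers at `v` (shifted to index `N+1` and
transferred to the FK ground state `Φ₀` by `stub_occupationFloorFK_of_window`, p120721) and the
removal-fidelity floor at `v` give the `N`-uniform floor `c₁c₂ ≤ A = L⁻³(∫Θ₀G)²`. [folklore] -/
theorem vhr_residueFloor_at (v : ℝ → ℝ≥0∞) (hv : IsRepulsiveFiniteRange v)
    (hBEC : ∃ ρ₀ : ℝ, 0 < ρ₀ ∧ ∀ ρ : ℝ, 0 < ρ → ρ < ρ₀ → ∃ c : ℝ, 0 < c ∧ ∀ᶠ N : ℕ in atTop,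
        ∃ δ : ℝ≥0∞, 0 < δ ∧ ∀ Ψ : PeriodicTrialState N (sideLength ρ N),
          periodicEnergy v Ψ ≤ periodicGroundStateEnergy v N (sideLength ρ N) + δ →
          ENNReal.ofReal (c * N) ≤ condensateOccupation N (sideLength ρ N) Ψ.ψ)
    (hFid : ∃ ρ₃ : ℝ, 0 < ρ₃ ∧ ∀ ρ : ℝ, 0 < ρ → ρ < ρ₃ → ∃ c₂ : ℝ, 0 < c₂ ∧
        ∀ᶠ N : ℕ in atTop, ∀ (L : ℝ), L = sideLength ρ (N + 1) →
          (∃ C : ℝ≥0, ∀ x, periodizedPotential v L x ≤ C) →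
          ∀ (Θ₀ : Config N → ℝ), IsPeriodicGroundStateFK v L Θ₀ → Continuous Θ₀ → (∀ X, 0 < Θ₀ X) →
          ∀ (Φ₀ : Config (N + 1) → ℝ), IsPeriodicGroundStateFK v L Φ₀ → Continuous Φ₀ →
            (∀ X, 0 < Φ₀ X) →
          ∀ (G : Config N → ℝ), (G = fun X => ∫ x in cell L, Φ₀ (vecCons x X)) →
            ENNReal.ofReal c₂ * ∫⁻ X in cellN N L, ENNReal.ofReal (G X) ^ 2 ≤
              ENNReal.ofReal ((∫ X in cellN N L, Θ₀ X * G X) ^ 2)) :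
    ∃ ρ₂ : ℝ, 0 < ρ₂ ∧ ∀ ρ : ℝ, 0 < ρ → ρ < ρ₂ → ∃ c : ℝ, 0 < c ∧
      ∀ᶠ N : ℕ in atTop, ∀ (L : ℝ), L = sideLength ρ (N + 1) →
        (∃ C : ℝ≥0, ∀ x, periodizedPotential v L x ≤ C) →
        ∀ (Θ₀ : Config N → ℝ), IsPeriodicGroundStateFK v L Θ₀ → Continuous Θ₀ → (∀ X, 0 < Θ₀ X) →
        ∀ (Φ₀ : Config (N + 1) → ℝ), IsPeriodicGroundStateFK v L Φ₀ → Continuous Φ₀ →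
          (∀ X, 0 < Φ₀ X) →
          ENNReal.ofReal c ≤
            ENNReal.ofReal ((L ^ 3)⁻¹ *
              (∫ X in cellN N L, Θ₀ X * ∫ x in cell L, Φ₀ (vecCons x X)) ^ 2) := by
  obtain ⟨ρ₀, hρ₀, hBEC₀⟩ := hBEC
  obtain ⟨ρ₃, hρ₃, hFid₀⟩ := hFid
  refine ⟨min ρ₀ ρ₃, lt_min hρ₀ hρ₃, fun ρ hρ hρlt => ?_⟩
  have hρ₀' : ρ < ρ₀ := lt_of_lt_of_le hρlt (min_le_left _ _)
  have hρ₃' : ρ < ρ₃ := lt_of_lt_of_le hρlt (min_le_right _ _)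
  obtain ⟨c₁, hc₁, hBECc⟩ := hBEC₀ ρ hρ hρ₀'
  obtain ⟨c₂, hc₂, hFidc⟩ := hFid₀ ρ hρ hρ₃'
  refine ⟨c₁ * c₂, by positivity, ?_⟩
  -- shift the BEC statement to index `N + 1`
  have hBEC' : ∀ᶠ N : ℕ in atTop, ∃ δ : ℝ≥0∞, 0 < δ ∧
      ∀ Ψ : PeriodicTrialState (N + 1) (sideLength ρ (N + 1)),
        periodicEnergy v Ψ ≤ periodicGroundStateEnergy v (N + 1) (sideLength ρ (N + 1)) + δ →
        ENNReal.ofReal (c₁ * ((N : ℝ) + 1)) ≤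
          condensateOccupation (N + 1) (sideLength ρ (N + 1)) Ψ.ψ := by
    have h := (tendsto_add_atTop_nat 1).eventually hBECc
    filter_upwards [h] with N hN
    obtain ⟨δ, hδ, hΨ⟩ := hN
    refine ⟨δ, hδ, fun Ψ hΨE => ?_⟩
    have := hΨ Ψ hΨE
    simpa [Nat.cast_succ] using this
  filter_upwards [hBEC', hFidc] with N hBECN hFidN L hL_def hb Θ₀ hΘ hΘc hΘp Φ₀ hΦ hΦc hΦp
  have hL : 0 < L := by rw [hL_def]; exact sideLength_succ_pos hρ N
  obtain ⟨δ, hδ, hwin⟩ := hBECN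
  set G : Config N → ℝ := fun X => ∫ x in cell L, Φ₀ (vecCons x X) with hG_def
  -- factor 1: `c₁ ≤ f₀(Φ₀)`
  have hf₀ : ENNReal.ofReal c₁ ≤ taggedZeroModeOccupation N L (fun X => (Φ₀ X : ℂ)) := by
    subst hL_def
    exact stub_occupationFloorFK_of_window v hv.1 N _ hL hb Φ₀ hΦ hΦc hΦp c₁ hc₁.le δ hδ hwin
  rw [taggedZeroModeOccupation_ofReal_eq L hΦp] at hf₀
  -- factor 2: `c₂ ∫ G² ≤ (∫ Θ₀ G)²`
  have hF : ENNReal.ofReal c₂ * ∫⁻ X in cellN N L, ENNReal.ofReal (G X) ^ 2 ≤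
      ENNReal.ofReal ((∫ X in cellN N L, Θ₀ X * G X) ^ 2) :=
    hFidN L hL_def hb Θ₀ hΘ hΘc hΘp Φ₀ hΦ hΦc hΦp G rfl
  -- combine: `c₁ c₂ ≤ c₂ · (L³)⁻¹ ∫G² ≤ (L³)⁻¹ (∫Θ₀G)²`
  calc ENNReal.ofReal (c₁ * c₂)
      = ENNReal.ofReal c₂ * ENNReal.ofReal c₁ := by
        rw [ENNReal.ofReal_mul hc₁.le, mul_comm]
    _ ≤ ENNReal.ofReal c₂ * ((ENNReal.ofReal L ^ 3)⁻¹ *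
          ∫⁻ X in cellN N L, ENNReal.ofReal (G X) ^ 2) := by gcongr
    _ = (ENNReal.ofReal L ^ 3)⁻¹ *
          (ENNReal.ofReal c₂ * ∫⁻ X in cellN N L, ENNReal.ofReal (G X) ^ 2) := by ring
    _ ≤ (ENNReal.ofReal L ^ 3)⁻¹ * ENNReal.ofReal ((∫ X in cellN N L, Θ₀ X * G X) ^ 2) := by
        gcongr
    _ = ENNReal.ofReal ((L ^ 3)⁻¹ * (∫ X in cellN N L, Θ₀ X * G X) ^ 2) := by
        rw [ENNReal.ofReal_mul (by positivity), ENNReal.ofReal_inv_of_pos (by positivity),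
          ENNReal.ofReal_pow hL.le]

/-- **The target body at one bounded potential from the two factors** (per-`v` form of the landed
`correctorClosure_of_factors`, p122159): thresholds `min ρᵢ`; eventually in `N` the torus FK ground
states exist, are continuous and positive with `v^per` bounded (`stub_groundStateExists`, p92339); the
floor `c ≤ A` (`residueFloor_at`); rigidity at `ε = c/2` (`stub_nearMinimiserRigidity`, p85784) moves it
to `c/2 ≤ Res(Θ, Ψ)` for some `δ`-near-minimiser `Θ` and every `δ`-near-minimiser `Ψ`. [folklore] -/
theorem vhr_insertionResidue_at (v : ℝ → ℝ≥0∞) (hv : IsRepulsiveFiniteRange v)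
    (hbdd : ∃ C : ℝ≥0, ∀ r, v r ≤ C)
    (hBEC : ∃ ρ₀ : ℝ, 0 < ρ₀ ∧ ∀ ρ : ℝ, 0 < ρ → ρ < ρ₀ → ∃ c : ℝ, 0 < c ∧ ∀ᶠ N : ℕ in atTop,
        ∃ δ : ℝ≥0∞, 0 < δ ∧ ∀ Ψ : PeriodicTrialState N (sideLength ρ N),
          periodicEnergy v Ψ ≤ periodicGroundStateEnergy v N (sideLength ρ N) + δ →
          ENNReal.ofReal (c * N) ≤ condensateOccupation N (sideLength ρ N) Ψ.ψ)
    (hFid : ∃ ρ₃ : ℝ, 0 < ρ₃ ∧ ∀ ρ : ℝ, 0 < ρ → ρ < ρ₃ → ∃ c₂ : ℝ, 0 < c₂ ∧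
        ∀ᶠ N : ℕ in atTop, ∀ (L : ℝ), L = sideLength ρ (N + 1) →
          (∃ C : ℝ≥0, ∀ x, periodizedPotential v L x ≤ C) →
          ∀ (Θ₀ : Config N → ℝ), IsPeriodicGroundStateFK v L Θ₀ → Continuous Θ₀ → (∀ X, 0 < Θ₀ X) →
          ∀ (Φ₀ : Config (N + 1) → ℝ), IsPeriodicGroundStateFK v L Φ₀ → Continuous Φ₀ →
            (∀ X, 0 < Φ₀ X) →
          ∀ (G : Config N → ℝ), (G = fun X => ∫ x in cell L, Φ₀ (vecCons x X)) →
            ENNReal.ofReal c₂ * ∫⁻ X in cellN N L, ENNReal.ofReal (G X) ^ 2 ≤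
              ENNReal.ofReal ((∫ X in cellN N L, Θ₀ X * G X) ^ 2)) :
    ∃ ρ₀ : ℝ, 0 < ρ₀ ∧ ∀ ρ : ℝ, 0 < ρ → ρ < ρ₀ → ∃ c : ℝ, 0 < c ∧ ∀ᶠ N : ℕ in Filter.atTop,
      ∃ δ : ENNReal, 0 < δ ∧ ∃ Θ : PeriodicTrialState N (sideLength ρ (N + 1)),
        periodicEnergy v Θ ≤ periodicGroundStateEnergy v N (sideLength ρ (N + 1)) + δ ∧
        ∀ Ψ : PeriodicTrialState (N + 1) (sideLength ρ (N + 1)),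
          periodicEnergy v Ψ ≤ periodicGroundStateEnergy v (N + 1) (sideLength ρ (N + 1)) + δ →
          ENNReal.ofReal c ≤ ENNReal.ofReal ((sideLength ρ (N + 1) ^ 3)⁻¹) *
            (‖∫ X in cellN N (sideLength ρ (N + 1)), conj (Θ.ψ X) *
                ∫ x in cell (sideLength ρ (N + 1)), Ψ.ψ (vecCons x X)‖₊ : ℝ≥0∞) ^ 2 := by
  obtain ⟨ρA, hρA, hGS⟩ := stub_groundStateExists v hv hbdd
  obtain ⟨ρ₂, hρ₂, hFl⟩ := vhr_residueFloor_at v hv hBEC hFid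
  refine ⟨min ρA ρ₂, lt_min hρA hρ₂, fun ρ hρ hρlt => ?_⟩
  have hρA' : ρ < ρA := lt_of_lt_of_le hρlt (min_le_left _ _)
  have hρ₂' : ρ < ρ₂ := lt_of_lt_of_le hρlt (min_le_right _ _)
  obtain ⟨c, hc, hFlc⟩ := hFl ρ hρ hρ₂'
  refine ⟨c / 2, by positivity, ?_⟩
  filter_upwards [hGS ρ hρ hρA', hFlc] with N hGSN hFlN
  obtain ⟨hb, ⟨hΘ, hΘc, hΘp⟩, ⟨hΦ, hΦc, hΦp⟩⟩ := hGSN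
  set L : ℝ := sideLength ρ (N + 1) with hL_def
  have hL : 0 < L := sideLength_succ_pos hρ N
  set Θ₀ : Config N → ℝ := periodicFKGroundState v N L with hΘ₀_def
  set Φ₀ : Config (N + 1) → ℝ := periodicFKGroundState v (N + 1) L with hΦ₀_def
  set A : ℝ≥0∞ := ENNReal.ofReal ((L ^ 3)⁻¹ *
      (∫ X in cellN N L, Θ₀ X * ∫ x in cell L, Φ₀ (vecCons x X)) ^ 2) with hA_def
  -- the floor: `c ≤ A`
  have hfloor : ENNReal.ofReal c ≤ A := hFlN L rfl hb Θ₀ hΘ hΘc hΘp Φ₀ hΦ hΦc hΦp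
  -- rigidity at `ε = c/2`: transfer to the near-minimiser frame
  obtain ⟨δ, hδ, Θ, hΘE, hΨ⟩ := stub_nearMinimiserRigidity v hv N L hL hb Θ₀ hΘ hΘc hΘp Φ₀ hΦ hΦc
    hΦp (c / 2) (by positivity)
  refine ⟨δ, hδ, Θ, hΘE, fun Ψ hΨE => ?_⟩
  set R : ℝ≥0∞ := ENNReal.ofReal ((L ^ 3)⁻¹) *
      (‖∫ X in cellN N L, conj (Θ.ψ X) * ∫ x in cell L, Ψ.ψ (vecCons x X)‖₊ : ℝ≥0∞) ^ 2 with hR_def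
  have hAR : A ≤ R + ENNReal.ofReal (c / 2) := hΨ Ψ hΨE
  have hsplit : ENNReal.ofReal c = ENNReal.ofReal (c / 2) + ENNReal.ofReal (c / 2) := by
    rw [← ENNReal.ofReal_add (by positivity) (by positivity)]
    congr 1; ring
  have h2 : ENNReal.ofReal (c / 2) + ENNReal.ofReal (c / 2) ≤ R + ENNReal.ofReal (c / 2) := by
    rw [← hsplit]; exact hfloor.trans hAR
  exact (ENNReal.add_le_add_iff_right ENNReal.ofReal_ne_top).1 h2

/-! ## Composition (sorry-free): the four open stub signatures of skeleton v2 give the crux BY NAME -/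

/-- **`CorrectorClosure` from the four open hearts of skeleton v2 (kernel-checked; K1 consumed inside
`periodicBEC_of_densityUniformHearts` via `stub_longWaveStructureOfSRB`).** Hypotheses, each VERBATIM the
body of a registered open stub of `Lines/volume_homotopy_sum_rule_domination.lean` v2, universally closed
over its potential class: `h₂` = S2 `stub_nonCondensateRemaindersUniform` (12615′) and `h₃` = S3
`stub_condensateNumberConcentrationUniform` (12616′) for every smooth-class `v`; `hR` = R
`stub_regularRemovalSusceptibility` for every bounded admissible `v`; `hHole` = S7 `stub_nonSmoothClassCase`
(the target body outside the smooth bounded class, given K1). Case split on the smooth bounded class: inside,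
`vhr_insertionResidue_at` (fixed-`N` FK frame p92339/p120721/p85784) fed with
`periodicBEC_of_densityUniformHearts hK1 …` and `removalFidelity_of_regularRemovalSusceptibility …`; outside,
`hHole`. So, kernel-checked: `CorrectorClosure ⇐ (∀ smooth v, 12615′ ∧ 12616′) ∧ (∀ bounded v, R) ∧ S7`.
[folklore] -/
theorem correctorClosure_of_densityUniformHearts
    (h₂ : ∀ v : ℝ → ℝ≥0∞, IsRepulsiveFiniteRange v → (∀ r, v r ≠ ⊤) → ContDiff ℝ 2 (fun x : Space => (v ‖x‖).toReal) →
      (∃ Cₑ : ℝ, ∀ x : Space,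
        ‖iteratedFDeriv ℝ 2 (fun x : Space => (v ‖x‖).toReal) x‖ ≤ Cₑ * Real.sqrt ((v ‖x‖).toReal)) →
      ∀ Λ : ℝ, 0 < Λ → ∀ ε : ℝ, 0 < ε → ∃ ρ₀ : ℝ, 0 < ρ₀ ∧ ∀ᶠ N : ℕ in atTop, ∀ L : ℝ,
      sideLength ρ₀ N ≤ L → ∀ Ψ : PeriodicTrialState N L,
      periodicEnergy v Ψ = periodicGroundStateEnergy v N L → periodicEnergy v Ψ ≠ ⊤ →
      (∑' n : Fin 3 → ℤ,
      {n : Fin 3 → ℤ | n ≠ 0 ∧ ‖((2 * Real.pi / L) • latticeVec 1 n)‖ <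
      Λ * Real.sqrt ((N : ℝ) / L ^ 3 * (scatteringLength v).toReal)}.indicator
      (fun n =>
      (∫⁻ X in cellN N L,
      (‖∑ j : Fin N,
      (cellWave L n (X j) *
      ((-2 * Complex.I) * fderiv ℝ Ψ.ψ X (Pi.single j ((2 * Real.pi / L) • latticeVec 1 n)) +
      (((‖((2 * Real.pi / L) • latticeVec 1 n)‖ ^ 2 : ℝ)) : ℂ) *
      (Ψ.ψ X - (((L ^ 3)⁻¹ : ℝ) : ℂ) * ∫ y in cell L, Ψ.ψ (Function.update X j y))) +
      (((‖((2 * Real.pi / L) • latticeVec 1 n)‖ ^ 2 : ℝ)) : ℂ) *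
      ((((L ^ 3)⁻¹ : ℝ) : ℂ) *
      ∫ y in cell L, cellWave L n y * Ψ.ψ (Function.update X j y)))‖₊ : ℝ≥0∞) ^ 2) /
      ENNReal.ofReal (‖((2 * Real.pi / L) • latticeVec 1 n)‖ ^ 4) +
      (∫⁻ X in cellN N L,
      (‖∑ j : Fin N,
      (cellWave L n (X j) *
      (Ψ.ψ X - (((L ^ 3)⁻¹ : ℝ) : ℂ) * ∫ y in cell L, Ψ.ψ (Function.update X j y)) -
      (((L ^ 3)⁻¹ : ℝ) : ℂ) *
      ∫ y in cell L, cellWave L n y * Ψ.ψ (Function.update X j y))‖₊ : ℝ≥0∞) ^ 2))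
      n) ≤
      ENNReal.ofReal (ε * (N : ℝ) ^ 2))
    (h₃ : ∀ v : ℝ → ℝ≥0∞, IsRepulsiveFiniteRange v → (∀ r, v r ≠ ⊤) → ContDiff ℝ 2 (fun x : Space => (v ‖x‖).toReal) →
      (∃ Cₑ : ℝ, ∀ x : Space,
        ‖iteratedFDeriv ℝ 2 (fun x : Space => (v ‖x‖).toReal) x‖ ≤ Cₑ * Real.sqrt ((v ‖x‖).toReal)) →
      ∀ ζ : ℝ, 0 < ζ → ∃ ρ₀ : ℝ, 0 < ρ₀ ∧ ∀ᶠ n : ℕ in atTop, ∀ L : ℝ, sideLength ρ₀ (n + 2) ≤ L →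
      ∀ Ψ : PeriodicTrialState (n + 2) L,
      periodicEnergy v Ψ = periodicGroundStateEnergy v (n + 2) L → periodicEnergy v Ψ ≠ ⊤ →
      ((n + 2 : ℕ) : ℝ≥0∞) * ((n + 1 : ℕ) : ℝ≥0∞) *
      (∫⁻ Y in cellN n L,
      (‖∫ x in cell L, ∫ y in cell L, Ψ.ψ (vecCons x (vecCons y Y))‖₊ : ℝ≥0∞) ^ 2) /
      ENNReal.ofReal (L ^ 6) +
      condensateOccupation (n + 2) L Ψ.ψ ≤
      condensateOccupation (n + 2) L Ψ.ψ ^ 2 + ENNReal.ofReal (ζ * ((n : ℝ) + 2) ^ 2))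
    (hR : ∀ v : ℝ → ℝ≥0∞, IsRepulsiveFiniteRange v → (∃ C : ℝ≥0, ∀ r, v r ≤ C) →
      ∃ ρ₃ : ℝ, 0 < ρ₃ ∧ ∀ ρ : ℝ, 0 < ρ → ρ < ρ₃ → ∃ η : ℝ, 0 ≤ η ∧ η < 1 ∧
      ∀ᶠ N : ℕ in atTop, ∀ (L : ℝ), L = sideLength ρ (N + 1) →
      (∃ C : ℝ≥0, ∀ x, periodizedPotential v L x ≤ C) →
      ∀ (Θ₀ : Config N → ℝ), IsPeriodicGroundStateFK v L Θ₀ → Continuous Θ₀ → (∀ X, 0 < Θ₀ X) →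
      ∀ (Φ₀ : Config (N + 1) → ℝ), IsPeriodicGroundStateFK v L Φ₀ → Continuous Φ₀ →
      (∀ X, 0 < Φ₀ X) →
      ∀ (G : Config N → ℝ), (G = fun X => ∫ x in cell L, Φ₀ (vecCons x X)) →
      ∃ B : ℝ, 0 ≤ B ∧
      hMinusOneSqW L Θ₀ (fun X => G X / Θ₀ X - ∫ Y in cellN N L, Θ₀ Y * G Y) ≤
      ENNReal.ofReal B ∧
      ((periodicGroundStateEnergy v (N + 1) L).toReal
      - (periodicGroundStateEnergy v N L).toReal) * B ≤
      η * ∫ X in cellN N L, G X ^ 2)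
    (hHole : StaticResponseBound → ∀ v : ℝ → ℝ≥0∞, IsRepulsiveFiniteRange v →
      ¬ ((∀ r, v r ≠ ⊤) ∧ ContDiff ℝ 2 (fun x : Space => (v ‖x‖).toReal) ∧
      (∃ Cₑ : ℝ, ∀ x : Space,
      ‖iteratedFDeriv ℝ 2 (fun x : Space => (v ‖x‖).toReal) x‖ ≤ Cₑ * Real.sqrt ((v ‖x‖).toReal)) ∧
      (∃ M : ℝ≥0, ∀ r, v r ≤ M)) →
      ∃ ρ₀ : ℝ, 0 < ρ₀ ∧ ∀ ρ : ℝ, 0 < ρ → ρ < ρ₀ → ∃ c : ℝ, 0 < c ∧ ∀ᶠ N : ℕ in Filter.atTop,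
      ∃ δ : ENNReal, 0 < δ ∧ ∃ Θ : PeriodicTrialState N (sideLength ρ (N + 1)),
      periodicEnergy v Θ ≤ periodicGroundStateEnergy v N (sideLength ρ (N + 1)) + δ ∧
      ∀ Ψ : PeriodicTrialState (N + 1) (sideLength ρ (N + 1)),
      periodicEnergy v Ψ ≤ periodicGroundStateEnergy v (N + 1) (sideLength ρ (N + 1)) + δ →
      ENNReal.ofReal c ≤ ENNReal.ofReal ((sideLength ρ (N + 1) ^ 3)⁻¹) *
      (‖∫ X in cellN N (sideLength ρ (N + 1)), conj (Θ.ψ X) *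
      ∫ x in cell (sideLength ρ (N + 1)), Ψ.ψ (vecCons x X)‖₊ : ℝ≥0∞) ^ 2) :
    CorrectorClosure := by
  intro hK1 v hv
  by_cases hcls : ((∀ r, v r ≠ ⊤) ∧ ContDiff ℝ 2 (fun x : Space => (v ‖x‖).toReal) ∧
      (∃ Cₑ : ℝ, ∀ x : Space,
        ‖iteratedFDeriv ℝ 2 (fun x : Space => (v ‖x‖).toReal) x‖ ≤ Cₑ * Real.sqrt ((v ‖x‖).toReal)) ∧
      (∃ M : ℝ≥0, ∀ r, v r ≤ M))
  · obtain ⟨hfin, hC2, hedge, hbdd⟩ := hcls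
    exact vhr_insertionResidue_at v hv hbdd
      (periodicBEC_of_densityUniformHearts hK1 v hv hfin hC2 hedge (h₂ v hv hfin hC2 hedge)
        (h₃ v hv hfin hC2 hedge))
      (removalFidelity_of_regularRemovalSusceptibility v hv (hR v hv hbdd))
  · exact hHole hK1 v hv hcls

end Summit.AtomisticToContinuum.BoseEinsteinCondensation.Theorems.CorrectorClosure.VolumeHomotopySumRuleDomination

end
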